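import Summits.BirchSwinnertonDyer.BirchSwinnertonDyer.Theorems.SchneiderFreeAdditiveX3PoitouTateUnramifiedOrthogonalAllLevels
import Literature.AlgebraicTopology.SingularHomology.KroneckerInjectiveSelfInjective
import HarnessLib

/-!
# Poitou–Tate toolkit: Milne I Thm. 4.10(b) `Ker γ¹ ⊆ Im β¹` at EVERY admissible finite set of places
# `S` (the Selmer form consumed by `poitouTate_selmerStructure_duality_of_middleExact_canonical`)
# FOLLOWS from the ALL-PLACES middle exactness in the restricted product `P¹(K, M)`

Cell `bsd-schneider-ideate` (HOME `run/shared/lean/pub/bsd-schneider-ideate/`), seat `bsd-schneider-door-c6`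
(prover, generation 11).  PARTITION: board row B6 ∩ X3 ∩ sst-twist, `r = 1`, of `Rank1Residual.partition` —
CONTROL corner (crux `AnticycControlAdditiveK`, stmt-BirchSwinnertonDyer-19295; facts binder `ControlFacts` (i),
stmt-19538); types-the-object-of the INTERFACE of the single remaining input `hE` (Milne *ADT* I Thm. 4.10(b),
`r = 1`, inclusion `Ker γ¹ ⊆ Im β¹`, for THE invariant maps); closes nothing by itself (BSD is not advanced,
no case of Poitou–Tate is proved here).  THEOREMS ONLY.

The route's reduction files (`…PoitouTateSelmerComplementCanonical`, `…UnramifiedOrthogonalAllLevels`,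
`…MiddleExactSuperset`, door-c6 gen 5 / door-c4 gen 9 / door-c6 gen 7) consume `hE` in the FINITE-`S`
form: for every finite `S ⊇ {v ∣ ∞}` with `v ∉ S ⇒ v ∤ n ∧ M unramified at v`, every family
`t ∈ ∏_{v ∈ S} H¹(K_v, M)` orthogonal to `loc(H¹_S(K, M^D))` under `∑_{v ∈ S} inv_v(· ∪ ·)` is `loc|_S` of a
class of `H¹_S(K, M)` — Milne's theorem for the `S`-ramified Galois group `G_S` and the `P`-class formation
`(G_S, C_S)` (Milne I Prop. 4.2–Lemma 4.5: `U_S` cohomologically trivial, `lim Id_{F,S} = 0` by the principal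
ideal theorem, the identity component `D_S(K)`).  This file shows that it suffices to prove the statement
ONCE, for `S =` ALL places, i.e. for the full Galois group `Γ_K` and the class formation `(Γ_K, C̄ = lim C_F)`
(Milne I §4 with "`S` contains all primes", where "everything becomes much simpler", p. 49: `J_{F,S} = J_F`,
`E_{F,S} = F^×`, `C_{F,S} = C_F`):

* **`middleExact_of_allPlaces`** — for a family `inv` with `IsPerfect` (local Tate duality at the finite
  places) and `UnramifiedOrthogonal` (Milne I Thm. 2.6), a finite `n`-torsion `M`, and the ALL-PLACES
  hypothesis `hA`: «for every admissible finite `T` and every `t ∈ P¹(K, M)` supported on `T` (`t_v ∈ H¹_ur`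
  off `T`) such that `∑_{v ∈ T'} inv_v(t_v ∪ loc_v y) = 0` for every `y ∈ H¹(K, M^D)` and every finite
  `T' ⊇ T` outside which `y` is unramified (this is `t ∈ Ker γ¹`, the sum being `γ¹(t)(y)` computed on any
  finite set carrying the supports), there is `x ∈ H¹(K, M)` with `loc_v x = t_v` at EVERY place» —
  the finite-`S` statement `hE(M, S)` holds at every admissible `S`.
  MECHANISM (pure algebra, no class field theory): given `t` on `S` orthogonal to `H¹_S(K, M^D)`, the
  functional `λ(y) = ∑_{v∈S} ⟨t_v, y_v⟩_v` on `H¹(K, M^D)` vanishes on `H¹_S(K, M^D) = ker(locQ)`,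
  `locQ : H¹(K, M^D) → ∏_{v ∉ S} H¹(K_v, M^D)/H¹_ur`; since `ℤ/n` is self-injective (the tree's
  `ZMod.baer_self`) `λ` extends to `Λ` on the whole product; by local Tate duality (`IsPerfect`) the
  restriction of `Λ` to the `v`-th factor is `⟨u_v, ·⟩_v` for a unique `u_v ∈ H¹(K_v, M)`, which annihilates
  `H¹_ur(K_v, M^D)` and is therefore unramified (Milne I 2.6, `UnramifiedOrthogonal`); the element
  `t' = (t on S, −u off S)` of `P¹(K, M)` is orthogonal to ALL of `H¹(K, M^D)`, so `hA` gives `x` with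
  `loc x = t'`: `loc_v x = t_v` on `S` and `loc_v x = −u_v ∈ H¹_ur` off `S`.
* **`middleExact_canonical_of_allPlaces`**, **`poitouTate_selmerStructure_duality_of_allPlaces_canonical`**
  — the same for THE invariant maps `LocalInvariants.canonical K n` (`canonical_isPerfect`,
  `unramifiedOrthogonal_of_isPerfect_allLevels`), and the NAMED FACT `poitouTate_selmerStructure_duality K`
  (conjunct (i) of the route's `ControlFacts`, ~1 300 consumers) from the all-places statement at every
  level `n ≥ 1` alone.

Consequence for Route A (the class-formation proof of `hE`, cells door-c4/door-c5/door-c6): the `Ext`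
long exact sequence may be run for `0 → K̄ˣ → J̄ → C̄ → 0` over `Γ_K` (`Ext^r(M^D, K̄ˣ) = H^r(K, M)` because
`K̄ˣ` is divisible — Milne I Lemma 4.12 with `E_S = K̄ˣ`), with no `K_S`, no `U_S`, no `P`-class-formation
bookkeeping and no capitulation; the arithmetic input of Thm. 1.8 (b) is then `α¹(Γ_F, ℤ/m)` for the FULL
idèle class group (`C_F/m ≅ Γ_F^{ab}/m`, i.e. `m·C_F` closed of finite index — existence theorem), versus the
finite-`S` form `C_F/(C_F^m·U_{F,S}) ≅ G_{F,S}^{ab}/m`.  Which road is cheaper is the planners' call; this file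
only makes the all-places road admissible at the interface.

References: [MilneADT2006] I §4 pp. 49–51 (notations, Lemma 4.1, Prop. 4.2–4.3), Thm. 2.6, Thm. 4.10 (b);
[Howard2004HeegnerKolyvagin] Thm. 2.1.11; [Lam1999] §15 (`ℤ/n` self-injective).
-/

noncomputable section

open Function NumberField IsDedekindDomain
open scoped NumberField

universe u

set_option linter.dupNamespace false
set_option autoImplicit false

namespace Summit.BirchSwinnertonDyer.BirchSwinnertonDyer.Theorems.SchneiderFreeAdditiveX3.PoitouTateReduction

open Field
open Literature.NumberTheory.GaloisRepresentations Literature.NumberTheory.GaloisCohomology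
open Literature.NumberTheory.GaloisRepresentations.DiscreteGaloisModule (mu TateDual tateDual
  localTatePairingZMod unramifiedSubgroup)
open Literature.AlgebraicTopology.SingularHomology (ZMod.baer_self)

/-! ## §0. Extension of `ℤ/n`-valued functionals (self-injectivity of `ℤ/n`) -/

section Extension

/-- **Every `ℤ/n`-valued additive functional defined on the image of a homomorphism into an
`n`-torsion abelian group extends to the whole group**: if `φ : Y → D`, `n·D = 0`, and `λ : Y → ℤ/n`
vanishes on `ker φ`, then `λ = Λ ∘ φ` for some `Λ : D → ℤ/n`.  (`λ` descends to `Y/ker φ ↪ D`, and `ℤ/n` is an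
injective `ℤ/n`-module — Baer's criterion, the tree's `ZMod.baer_self`.)
[cite: Lam1999, §15 (ℤ/nℤ is self-injective) and §3B Thm. 3.7] -/
theorem exists_addMonoidHom_comp_eq_of_ker_le {n : ℕ} [NeZero n] {Y D : Type*} [AddCommGroup Y]
    [AddCommGroup D] (hD : ∀ d : D, n • d = 0) (φ : Y →+ D) (lam : Y →+ ZMod n)
    (hker : ∀ y, φ y = 0 → lam y = 0) : ∃ Λ : D →+ ZMod n, ∀ y, Λ (φ y) = lam y := by
  -- descend `λ` and `φ` to the quotient by `ker φ`
  let φ' : Y ⧸ φ.ker →+ D := QuotientAddGroup.kerLift φ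
  have hφ' : Injective φ' := QuotientAddGroup.kerLift_injective φ
  let lam' : Y ⧸ φ.ker →+ ZMod n :=
    QuotientAddGroup.lift φ.ker lam fun y hy => (AddMonoidHom.mem_ker).2 (hker y hy)
  have hQ : ∀ q : Y ⧸ φ.ker, n • q = 0 := fun q => hφ' (by rw [map_nsmul, hD, map_zero])
  letI : Module (ZMod n) (Y ⧸ φ.ker) := AddCommGroup.zmodModule hQ
  letI : Module (ZMod n) D := AddCommGroup.zmodModule hD
  obtain ⟨h, hh⟩ := (ZMod.baer_self n).extension_property (φ'.toZModLinearMap n) hφ'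
    (lam'.toZModLinearMap n)
  refine ⟨h.toAddMonoidHom, fun y => ?_⟩
  have h1 := LinearMap.congr_fun hh (QuotientAddGroup.mk y)
  simp only [LinearMap.coe_comp, Function.comp_apply, AddMonoidHom.coe_toZModLinearMap] at h1
  rw [QuotientAddGroup.kerLift_mk] at h1
  rw [LinearMap.toAddMonoidHom_coe, h1]
  exact QuotientAddGroup.lift_mk _ _ y

end Extension

/-! ## §1. Finite `S` from all places -/

section AllPlaces

variable {K : Type u} [Field K] [NumberField K] {n : ℕ} [NeZero n]
variable {M : Type u} [AddCommGroup M] [TopologicalSpace M] [DiscreteTopology M] [Finite M]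

/-- **Milne I Thm. 4.10(b) `Ker γ¹ ⊆ Im β¹` at every admissible finite `S` from the ALL-PLACES middle
exactness.**  Let `inv` be a family of local invariant maps, perfect at the finite places (`IsPerfect`,
local Tate duality) and satisfying Milne I Thm. 2.6 (`UnramifiedOrthogonal`); `M` finite `n`-torsion.
Hypothesis `hA` (middle exactness of `H¹(K, M) → P¹(K, M) → H¹(K, M^D)^*`, `P¹` the restricted product over
ALL places): for every finite `T ⊇ {v ∣ ∞}` with `v ∉ T ⇒ v ∤ n ∧ M unramified at v` and every family
`t = (t_v)_v` with `t_v ∈ H¹_ur(K_v, M)` for finite `v ∉ T`, if `∑_{v ∈ T'} inv_v(t_v ∪ loc_v y) = 0` for every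
`y ∈ H¹(K, M^D)` and every finite `T' ⊇ T` outside which `y` is unramified, then `t = loc x` at every place for
some `x ∈ H¹(K, M)`.  Conclusion: for every finite `S ⊇ {v ∣ ∞}` with `v ∉ S ⇒ v ∤ n ∧ M unramified at v`,
every family `t` on `S` with `∑_{v∈S} inv_v(t_v ∪ loc_v y) = 0` for all `y ∈ H¹_S(K, M^D)` (unramified off `S`)
is `loc|_S x` for some `x ∈ H¹(K, M)` unramified off `S`.  Proof: extend `y ↦ ∑_{v∈S}⟨t_v, y_v⟩_v`, which kills
`H¹_S(K, M^D) = ker(H¹(K, M^D) → ∏_{v∉S} H¹(K_v, M^D)/H¹_ur)`, to the product (`ℤ/n` self-injective); factor by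
factor the extension is `⟨u_v, ·⟩_v` with `u_v` unramified (local duality + Thm. 2.6); apply `hA` to
`(t on S, −u off S)`. [cite: MilneADT2006, Ch. I, Thm. 4.10(b) and Thm. 2.6]
[cite: Howard2004HeegnerKolyvagin, Thm. 2.1.11 (arXiv:1202.6340 p. 6)] -/
theorem middleExact_of_allPlaces (inv : LocalInvariants K n) (hperf : inv.IsPerfect)
    (hUO : inv.UnramifiedOrthogonal) (ρ : DiscreteGaloisModule K M) (hM : ∀ m : M, n • m = 0)
    (hA : ∀ T : Finset (Place K), (∀ w : InfinitePlace K, (Sum.inl w : Place K) ∈ T) →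
      (∀ v : HeightOneSpectrum (𝓞 K), (Sum.inr v : Place K) ∉ T →
        ((n : ℕ) : 𝓞 K) ∉ v.asIdeal ∧ GaloisRep.IsUnramifiedAt v ρ) →
      ∀ t : Π v : Place K, galoisCohomology (ρ.toLocal v) 1,
        (∀ v : HeightOneSpectrum (𝓞 K), (Sum.inr v : Place K) ∉ T →
          t (Sum.inr v) ∈ unramifiedSubgroup (GaloisRep.toLocal v ρ) 1) →
        (∀ (y : galoisCohomology (ρ.tateDual n) 1) (T' : Finset (Place K)), T ⊆ T' →
          (∀ v : HeightOneSpectrum (𝓞 K), (Sum.inr v : Place K) ∉ T' →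
            galoisCohomology.localization (ρ.tateDual n) (Sum.inr v) 1 y ∈
              unramifiedSubgroup (GaloisRep.toLocal v (ρ.tateDual n)) 1) →
          ∑ v ∈ T', localTatePairingZMod ρ n v (inv v) (t v)
            (galoisCohomology.localization (ρ.tateDual n) v 1 y) = 0) →
        ∃ x : galoisCohomology ρ 1, ∀ v : Place K, galoisCohomology.localization ρ v 1 x = t v)
    {S : Finset (Place K)} (hinf : ∀ w : InfinitePlace K, (Sum.inl w : Place K) ∈ S)
    (hS : ∀ v : HeightOneSpectrum (𝓞 K), (Sum.inr v : Place K) ∉ S →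
      ((n : ℕ) : 𝓞 K) ∉ v.asIdeal ∧ GaloisRep.IsUnramifiedAt v ρ)
    (t : Π v : Place K, galoisCohomology (ρ.toLocal v) 1)
    (horth : ∀ y : galoisCohomology (ρ.tateDual n) 1,
      (∀ v : HeightOneSpectrum (𝓞 K), (Sum.inr v : Place K) ∉ S →
        galoisCohomology.localization (ρ.tateDual n) (Sum.inr v) 1 y ∈
          unramifiedSubgroup (GaloisRep.toLocal v (ρ.tateDual n)) 1) →
      ∑ v ∈ S, localTatePairingZMod ρ n v (inv v) (t v)
        (galoisCohomology.localization (ρ.tateDual n) v 1 y) = 0) :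
    ∃ x : galoisCohomology ρ 1,
      (∀ v : HeightOneSpectrum (𝓞 K), (Sum.inr v : Place K) ∉ S →
        galoisCohomology.localization ρ (Sum.inr v) 1 x ∈ unramifiedSubgroup (GaloisRep.toLocal v ρ) 1) ∧
      ∀ v ∈ S, galoisCohomology.localization ρ v 1 x = t v := by
  classical
  -- the local groups `H¹(K_v, M^D)` and their unramified subgroups, `v` finite
  let H : HeightOneSpectrum (𝓞 K) → Type u := fun v =>
    galoisCohomology ((ρ.tateDual n).toLocal (Sum.inr v)) 1
  let U : Π v : HeightOneSpectrum (𝓞 K), AddSubgroup (H v) := fun v =>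
    unramifiedSubgroup (GaloisRep.toLocal v (ρ.tateDual n)) 1
  let loc : Π v : HeightOneSpectrum (𝓞 K), galoisCohomology (ρ.tateDual n) 1 →+ H v := fun v =>
    galoisCohomology.localization (ρ.tateDual n) (Sum.inr v) 1
  -- the target product `D = ∏_v H¹(K_v, M^D)/H¹_ur` (all finite `v`; the `S`-components are zeroed below)
  let D : Type u := Π v : HeightOneSpectrum (𝓞 K), H v ⧸ U v
  have hD : ∀ d : D, n • d = 0 := by
    intro d
    funext v
    obtain ⟨b, hb⟩ := QuotientAddGroup.mk_surjective (d v)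
    rw [Pi.smul_apply, Pi.zero_apply, ← hb, ← QuotientAddGroup.mk_nsmul,
      galoisCohomology.nsmul_eq_zero_of_forall _ (fun f => DiscreteGaloisModule.TateDual.nsmul_eq_zero f) b,
      QuotientAddGroup.mk_zero]
  -- `locQ : H¹(K, M^D) → D`, `y ↦ (loc_v y mod H¹_ur)_{v ∉ S}` (zero at the finite places of `S`)
  let locQv : Π v : HeightOneSpectrum (𝓞 K), galoisCohomology (ρ.tateDual n) 1 →+ H v ⧸ U v := fun v =>
    if (Sum.inr v : Place K) ∈ S then 0 else (QuotientAddGroup.mk' (U v)).comp (loc v)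
  let locQ : galoisCohomology (ρ.tateDual n) 1 →+ D := AddMonoidHom.pi locQv
  have locQ_apply_of_mem : ∀ (y : galoisCohomology (ρ.tateDual n) 1) (v : HeightOneSpectrum (𝓞 K)),
      (Sum.inr v : Place K) ∈ S → locQ y v = 0 := fun y v hv => by
    change (locQv v) y = 0
    simp only [locQv, if_pos hv, AddMonoidHom.zero_apply]
  have locQ_apply_of_not_mem : ∀ (y : galoisCohomology (ρ.tateDual n) 1) (v : HeightOneSpectrum (𝓞 K)),
      (Sum.inr v : Place K) ∉ S → locQ y v = QuotientAddGroup.mk (loc v y) := fun y v hv => by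
    change (locQv v) y = _
    simp only [locQv, if_neg hv, AddMonoidHom.coe_comp, Function.comp_apply, QuotientAddGroup.coe_mk']
  -- the functional `λ(y) = ∑_{v ∈ S} ⟨t_v, loc_v y⟩_v`
  let lam : galoisCohomology (ρ.tateDual n) 1 →+ ZMod n :=
    ∑ v ∈ S, (localTatePairingZMod ρ n v (inv v) (t v)).comp
      (galoisCohomology.localization (ρ.tateDual n) v 1)
  have lam_apply : ∀ y, lam y = ∑ v ∈ S, localTatePairingZMod ρ n v (inv v) (t v)
      (galoisCohomology.localization (ρ.tateDual n) v 1 y) := fun y => by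
    simp only [lam, AddMonoidHom.finsetSum_apply, AddMonoidHom.coe_comp, Function.comp_apply]
  -- `λ` kills `ker locQ = H¹_S(K, M^D)`
  have hker : ∀ y, locQ y = 0 → lam y = 0 := by
    intro y hy
    rw [lam_apply]
    refine horth y fun v hv => ?_
    have h1 : locQ y v = 0 := by rw [hy]; rfl
    rw [locQ_apply_of_not_mem y v hv, QuotientAddGroup.eq_zero_iff] at h1
    exact h1
  -- extend `λ` to `Λ` on `D`
  obtain ⟨Λ, hΛ⟩ := exists_addMonoidHom_comp_eq_of_ker_le hD locQ lam hker
  -- factor by factor, `Λ` is `⟨u_v, ·⟩_v` (local Tate duality)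
  let F : Π v : HeightOneSpectrum (𝓞 K), H v →+ ZMod n := fun v =>
    Λ.comp ((AddMonoidHom.single (fun w => H w ⧸ U w) v).comp (QuotientAddGroup.mk' (U v)))
  have F_apply : ∀ (v : HeightOneSpectrum (𝓞 K)) (b : H v),
      F v b = Λ (Pi.single v (QuotientAddGroup.mk b : H v ⧸ U v)) := fun v b => rfl
  have F_apply_of_mem : ∀ (v : HeightOneSpectrum (𝓞 K)) (b : H v), b ∈ U v → F v b = 0 := by
    intro v b hb
    rw [F_apply, (QuotientAddGroup.eq_zero_iff b).2 hb, Pi.single_zero, map_zero]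
  choose u hu using fun v : HeightOneSpectrum (𝓞 K) => ((hperf v).2 ρ hM).1.2 (F v)
  -- `u_v` is unramified off `S` (Milne I 2.6)
  have hu_ur : ∀ v : HeightOneSpectrum (𝓞 K), (Sum.inr v : Place K) ∉ S →
      u v ∈ unramifiedSubgroup (GaloisRep.toLocal v ρ) 1 := by
    intro v hv
    refine (hUO ρ hM v (hS v hv).1 (hS v hv).2).2 (u v) fun b hb => ?_
    rw [hu v]
    exact F_apply_of_mem v b hb
  -- the corrected family `t' = (t on S, -u off S)`
  let t' : Π v : Place K, galoisCohomology (ρ.toLocal v) 1 := fun v =>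
    match v with
    | Sum.inl w => t (Sum.inl w)
    | Sum.inr v' => if (Sum.inr v' : Place K) ∈ S then t (Sum.inr v') else -u v'
  have ht'S : ∀ v ∈ S, t' v = t v := by
    intro v hv
    rcases v with w | v'
    · rfl
    · change (if (Sum.inr v' : Place K) ∈ S then t (Sum.inr v') else -u v') = _
      rw [if_pos hv]
  have ht'nS : ∀ v' : HeightOneSpectrum (𝓞 K), (Sum.inr v' : Place K) ∉ S → t' (Sum.inr v') = -u v' := by
    intro v' hv'
    change (if (Sum.inr v' : Place K) ∈ S then t (Sum.inr v') else -u v') = _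
    rw [if_neg hv']
  -- `t'` is orthogonal to ALL of `H¹(K, M^D)`
  have horth' : ∀ (y : galoisCohomology (ρ.tateDual n) 1) (T' : Finset (Place K)), S ⊆ T' →
      (∀ v : HeightOneSpectrum (𝓞 K), (Sum.inr v : Place K) ∉ T' →
        galoisCohomology.localization (ρ.tateDual n) (Sum.inr v) 1 y ∈
          unramifiedSubgroup (GaloisRep.toLocal v (ρ.tateDual n)) 1) →
      ∑ v ∈ T', localTatePairingZMod ρ n v (inv v) (t' v)
        (galoisCohomology.localization (ρ.tateDual n) v 1 y) = 0 := by
    intro y T' hST' hyT'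
    -- the finite places of `T' \ S`
    let P : Finset (HeightOneSpectrum (𝓞 K)) := (T' \ S).preimage Sum.inr (Sum.inr_injective.injOn)
    have hP : ∀ v' : HeightOneSpectrum (𝓞 K), v' ∈ P ↔ (Sum.inr v' : Place K) ∈ T' \ S := fun v' =>
      Finset.mem_preimage
    -- `locQ y` is supported on `P`
    have hsupp : (∑ v' ∈ P, Pi.single v' (locQ y v') : D) = locQ y := by
      funext w
      rw [Finset.sum_apply, Finset.sum_pi_single]
      by_cases hw : w ∈ P
      · rw [if_pos hw]
      · rw [if_neg hw]
        by_cases hwS : (Sum.inr w : Place K) ∈ S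
        · exact (locQ_apply_of_mem y w hwS).symm
        · have hwT' : (Sum.inr w : Place K) ∉ T' := fun h =>
            hw ((hP w).2 (Finset.mem_sdiff.2 ⟨h, hwS⟩))
          rw [locQ_apply_of_not_mem y w hwS, eq_comm, QuotientAddGroup.eq_zero_iff]
          exact hyT' w hwT'
    -- the sum over `T' \ S` is `-Λ(locQ y)`
    have hsdiff : ∑ v ∈ T' \ S, localTatePairingZMod ρ n v (inv v) (t' v)
        (galoisCohomology.localization (ρ.tateDual n) v 1 y) = -Λ (locQ y) := by
      rw [← Finset.sum_preimage Sum.inr (T' \ S) Sum.inr_injective.injOn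
        (fun v => localTatePairingZMod ρ n v (inv v) (t' v)
          (galoisCohomology.localization (ρ.tateDual n) v 1 y)) (fun v hv hrange => ?_)]
      · rw [← hsupp, map_sum, ← Finset.sum_neg_distrib]
        refine Finset.sum_congr rfl fun v' hv' => ?_
        have hv'S : (Sum.inr v' : Place K) ∉ S := (Finset.mem_sdiff.1 ((hP v').1 hv')).2
        rw [ht'nS v' hv'S, map_neg, AddMonoidHom.neg_apply, hu v', F_apply,
          locQ_apply_of_not_mem y v' hv'S]
      · rcases v with w | v'
        · exact absurd (hinf w) (Finset.mem_sdiff.1 hv).2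
        · exact absurd ⟨v', rfl⟩ hrange
    have hsum_S : ∑ v ∈ S, localTatePairingZMod ρ n v (inv v) (t' v)
        (galoisCohomology.localization (ρ.tateDual n) v 1 y) = lam y := by
      rw [lam_apply]
      exact Finset.sum_congr rfl fun v hv => by rw [ht'S v hv]
    rw [← Finset.sum_sdiff hST', hsdiff, hsum_S, hΛ y, neg_add_cancel]
  -- apply the all-places hypothesis
  obtain ⟨x, hx⟩ := hA S hinf hS t' (fun v' hv' => by rw [ht'nS v' hv']; exact neg_mem (hu_ur v' hv'))
    horth'
  refine ⟨x, fun v' hv' => ?_, fun v hv => ?_⟩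
  · rw [hx (Sum.inr v'), ht'nS v' hv']
    exact neg_mem (hu_ur v' hv')
  · rw [hx v, ht'S v hv]

end AllPlaces

/-! ## §2. THE invariant maps -/

section Canonical

variable {K : Type} [Field K] [NumberField K] {n : ℕ} [NeZero n]
variable {M : Type} [AddCommGroup M] [TopologicalSpace M] [DiscreteTopology M] [Finite M]

/-- **For THE invariant maps `LocalInvariants.canonical K n`: Milne I Thm. 4.10(b) at every admissible finite
`S` follows from the all-places middle exactness `Im β¹ = Ker γ¹` in `P¹(K, M)`** (`canonical_isPerfect`,
`unramifiedOrthogonal_of_isPerfect_allLevels`).  Hence the hypothesis `hE` of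
`poitouTate_selmerStructure_duality_of_middleExact_canonical` may be proved over the FULL Galois group
`Γ_K` with the class formation `(Γ_K, C̄)` (all places) instead of `(G_S, C_S)` for every finite `S`.
[cite: MilneADT2006, Ch. I, Thm. 4.10(b) and Thm. 2.6] -/
theorem middleExact_canonical_of_allPlaces (ρ : DiscreteGaloisModule K M) (hM : ∀ m : M, n • m = 0)
    (hA : ∀ T : Finset (Place K), (∀ w : InfinitePlace K, (Sum.inl w : Place K) ∈ T) →
      (∀ v : HeightOneSpectrum (𝓞 K), (Sum.inr v : Place K) ∉ T →
        ((n : ℕ) : 𝓞 K) ∉ v.asIdeal ∧ GaloisRep.IsUnramifiedAt v ρ) →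
      ∀ t : Π v : Place K, galoisCohomology (ρ.toLocal v) 1,
        (∀ v : HeightOneSpectrum (𝓞 K), (Sum.inr v : Place K) ∉ T →
          t (Sum.inr v) ∈ unramifiedSubgroup (GaloisRep.toLocal v ρ) 1) →
        (∀ (y : galoisCohomology (ρ.tateDual n) 1) (T' : Finset (Place K)), T ⊆ T' →
          (∀ v : HeightOneSpectrum (𝓞 K), (Sum.inr v : Place K) ∉ T' →
            galoisCohomology.localization (ρ.tateDual n) (Sum.inr v) 1 y ∈
              unramifiedSubgroup (GaloisRep.toLocal v (ρ.tateDual n)) 1) →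
          ∑ v ∈ T', localTatePairingZMod ρ n v (LocalInvariants.canonical K n v) (t v)
            (galoisCohomology.localization (ρ.tateDual n) v 1 y) = 0) →
        ∃ x : galoisCohomology ρ 1, ∀ v : Place K, galoisCohomology.localization ρ v 1 x = t v)
    {S : Finset (Place K)} (hinf : ∀ w : InfinitePlace K, (Sum.inl w : Place K) ∈ S)
    (hS : ∀ v : HeightOneSpectrum (𝓞 K), (Sum.inr v : Place K) ∉ S →
      ((n : ℕ) : 𝓞 K) ∉ v.asIdeal ∧ GaloisRep.IsUnramifiedAt v ρ)
    (t : Π v : Place K, galoisCohomology (ρ.toLocal v) 1)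
    (horth : ∀ y : galoisCohomology (ρ.tateDual n) 1,
      (∀ v : HeightOneSpectrum (𝓞 K), (Sum.inr v : Place K) ∉ S →
        galoisCohomology.localization (ρ.tateDual n) (Sum.inr v) 1 y ∈
          unramifiedSubgroup (GaloisRep.toLocal v (ρ.tateDual n)) 1) →
      ∑ v ∈ S, localTatePairingZMod ρ n v (LocalInvariants.canonical K n v) (t v)
        (galoisCohomology.localization (ρ.tateDual n) v 1 y) = 0) :
    ∃ x : galoisCohomology ρ 1,
      (∀ v : HeightOneSpectrum (𝓞 K), (Sum.inr v : Place K) ∉ S →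
        galoisCohomology.localization ρ (Sum.inr v) 1 x ∈ unramifiedSubgroup (GaloisRep.toLocal v ρ) 1) ∧
      ∀ v ∈ S, galoisCohomology.localization ρ v 1 x = t v :=
  middleExact_of_allPlaces _ LocalInvariants.canonical_isPerfect
    (unramifiedOrthogonal_of_isPerfect_allLevels _ LocalInvariants.canonical_isPerfect) ρ hM hA hinf hS
    t horth

/-- **The Poitou–Tate Selmer-structure fact BY NAME from the ALL-PLACES middle exactness alone.**  For a
number field `K`: if for every level `n ≥ 1` and every finite discrete `Γ_K`-module `M` killed by `n`, Milne,
*ADT* I Thm. 4.10(b), `r = 1`, inclusion `Ker γ¹ ⊆ Im β¹` holds in the restricted product over ALL places for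
THE invariant maps `LocalInvariants.canonical K n` — every `t ∈ P¹(K, M)` (supported on an admissible finite
`T`, unramified off `T`) with `∑_v inv_v(t_v ∪ loc_v y) = 0` for all `y ∈ H¹(K, M^D)` (the sum taken over any
finite `T' ⊇ T` outside which `y` is unramified) is `loc x` at every place for some `x ∈ H¹(K, M)` — then
`poitouTate_selmerStructure_duality K` (Milne I Cor. 2.3 ∧ Thm. 4.10(b) `Im ⊆ Ker` ∧ Thm. 2.6 ∧ Howard 2004
Thm. 2.1.11) HOLDS, witnessed by the canonical family (`middleExact_canonical_of_allPlaces` feeding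
`poitouTate_selmerStructure_duality_of_middleExact_canonical`).  Conjunct (i) of the route's `ControlFacts`
(stmt-BirchSwinnertonDyer-19538), reduced to ONE statement about `(Γ_K, C̄)`.
[cite: MilneADT2006, Ch. I, Thm. 4.10(b)] [cite: Howard2004HeegnerKolyvagin, Thm. 2.1.11 (arXiv:1202.6340 p. 6)] -/
theorem poitouTate_selmerStructure_duality_of_allPlaces_canonical
    (hA : ∀ (n : ℕ) [NeZero n],
      ∀ ⦃M : Type⦄ [AddCommGroup M] [TopologicalSpace M] [DiscreteTopology M] [Finite M]
      (ρ : DiscreteGaloisModule K M), (∀ m : M, n • m = 0) →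
      ∀ T : Finset (Place K), (∀ w : InfinitePlace K, (Sum.inl w : Place K) ∈ T) →
        (∀ v : HeightOneSpectrum (𝓞 K), (Sum.inr v : Place K) ∉ T →
          ((n : ℕ) : 𝓞 K) ∉ v.asIdeal ∧ GaloisRep.IsUnramifiedAt v ρ) →
        ∀ t : Π v : Place K, galoisCohomology (ρ.toLocal v) 1,
          (∀ v : HeightOneSpectrum (𝓞 K), (Sum.inr v : Place K) ∉ T →
            t (Sum.inr v) ∈ unramifiedSubgroup (GaloisRep.toLocal v ρ) 1) →
          (∀ (y : galoisCohomology (ρ.tateDual n) 1) (T' : Finset (Place K)), T ⊆ T' →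
            (∀ v : HeightOneSpectrum (𝓞 K), (Sum.inr v : Place K) ∉ T' →
              galoisCohomology.localization (ρ.tateDual n) (Sum.inr v) 1 y ∈
                unramifiedSubgroup (GaloisRep.toLocal v (ρ.tateDual n)) 1) →
            ∑ v ∈ T', localTatePairingZMod ρ n v (LocalInvariants.canonical K n v) (t v)
              (galoisCohomology.localization (ρ.tateDual n) v 1 y) = 0) →
          ∃ x : galoisCohomology ρ 1, ∀ v : Place K, galoisCohomology.localization ρ v 1 x = t v) :
    poitouTate_selmerStructure_duality K :=
  poitouTate_selmerStructure_duality_of_middleExact_canonical fun n _ _ _ _ _ _ ρ hM _ hinf hS t horth =>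
    middleExact_canonical_of_allPlaces ρ hM (hA n ρ hM) hinf hS t horth

end Canonical

end Summit.BirchSwinnertonDyer.BirchSwinnertonDyer.Theorems.SchneiderFreeAdditiveX3.PoitouTateReduction

end
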